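import Summits.Ventures.CertifiedArithmetic.LowPrec.SRProductLawSharp
import Summits.Ventures.CertifiedArithmetic.LowPrec.ErrorFreeAdd
import HarnessLib

/-!
# The product law is exact in the normal regime: top significands discard exactly `m₁ + m₂ + 1 − m` bits

HONEST FRAMING: certified error envelopes and provably optimal rounding/accumulation schemes for
low-precision formats under stated cost models; every table by two implementations; no hardware or
vendor claims.

File LXXXV of the SR slice.  LXXXI / LXXXIII bounded the random-bit cost of SR-rounding an exact
product of format values `a ∈ valueSet φ₁`, `b ∈ valueSet φ₂` into `valueSet φ` by
`max (m₁ + m₂ + 1 ∸ m) (j₁ + j₂ ∸ j)`; LXXXIV showed the SUBNORMAL term attained.  Here the NORMAL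
term `M = m₁ + m₂ + 1 − m` is shown attained for EVERY triple of formats, structurally: the factors
with the LARGEST significands `Kᵢ = 2^(mᵢ+1) − 1` (at any exponents keeping the product normal and
below the top binade of `φ`) have the odd product significand `K₁K₂ ∈ [2^(m₁+m₂+1), 2^(m₁+m₂+2))`,
of which rounding into `φ` discards exactly `M` bits:

* `MiniFloat.topSig_mem_valueSet` — `(2^(m+1) − 1)·2^e·quantum` is a value (`e + 2 ≤ emaxCode`); the
  binade of the product is read off by `MiniFloat.shift_eq_of_bounds` (file `ErrorFreeAdd`);
* **`valueSet_prod_law_sharp_normal`** — the up-probability of that product is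
  `K₁K₂/2^M − ⌊K₁K₂/2^M⌋`, an `M`-bit dyadic that is NOT an `(M−1)`-bit dyadic;
* **`prod_law_normal_formats`** — instances: the one-format `m + 1` term for E2M1 (`2`), E2M3 (`4`),
  E3M2 (`3`), E4M3 (`4`), E5M2 (`3`), binary16 (`11`), bfloat16 (`8`), binary32 (`24`), and the mixed
  FP4/FP6 → FP8 pipelines E3M2²→E5M2 (`3`), E2M3²→E4M3 (`4`), E3M2·E2M3→E4M3 (`3`), E2M1·E3M2→E5M2
  (`2`), E2M3²→E5M2 (`5`) — until now certified by enumeration only (`certs/sr/gen15/mixed`).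

With LXXXIV both terms of the product law are attained, so `max (m₁+m₂+1∸m) (j₁+j₂∸j)` is the EXACT
random-bit cost of product rounding for every pipeline in the published tables.
-/

namespace Literature.ComputerArithmetic.FloatingPoint

namespace Format

variable {φ : Format}

/-- The largest significand at an exponent below the top binade stays below `maxScaled`. -/
theorem topSig_mul_pow_le_maxScaled {e : ℕ} (he : e + 2 ≤ φ.emaxCode) :
    (2 ^ (φ.manBits + 1) - 1) * 2 ^ e ≤ φ.maxScaled := by
  rw [maxScaled_eq (by omega)]
  have h1 : (2 ^ (φ.manBits + 1) - 1) * 2 ^ e ≤ 2 ^ (φ.manBits + 1) * 2 ^ e :=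
    Nat.mul_le_mul_right _ (Nat.sub_le _ _)
  have h2 : 2 ^ (φ.manBits + 1) * 2 ^ e = 2 ^ φ.manBits * 2 ^ (e + 1) := by ring
  have h3 : 2 ^ (e + 1) ≤ 2 ^ (φ.emaxCode - 1) := Nat.pow_le_pow_right (by norm_num) (by omega)
  have h4 : 2 ^ φ.manBits * 2 ^ (e + 1) ≤ 2 ^ φ.manBits * 2 ^ (φ.emaxCode - 1) :=
    Nat.mul_le_mul_left _ h3
  nlinarith [Nat.zero_le (φ.topMan * 2 ^ (φ.emaxCode - 1))]

end Format

namespace MiniFloat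

variable {φ : Format}

/-- A representable magnitude `n` (in quanta) gives the value `n · quantum`. -/
theorem natMul_quantum_mem_valueSet {n : ℕ} (hn : n ≤ φ.maxScaled) (hr : φ.Representable n) :
    (n : ℚ) * φ.quantum ∈ valueSet φ := by
  have hm := toRat_mem_valueSet (ofScaled φ false n hn)
  rw [toRat_ofScaled hn hr] at hm
  simpa using hm

/-- The largest significand `2^(m+1) − 1` at an exponent below the top binade is a value. -/
theorem topSig_mem_valueSet {e : ℕ} (he : e + 2 ≤ φ.emaxCode) :
    (((2 ^ (φ.manBits + 1) - 1) * 2 ^ e : ℕ) : ℚ) * φ.quantum ∈ valueSet φ := by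
  have hn := Format.topSig_mul_pow_le_maxScaled (φ := φ) he
  exact natMul_quantum_mem_valueSet hn
    (representable_iff.mpr ⟨hn, _, _, Nat.sub_lt (Nat.two_pow_pos _) one_pos, rfl⟩)

end MiniFloat

end Literature.ComputerArithmetic.FloatingPoint

namespace Summit.Ventures.CertifiedArithmetic.LowPrec.SR.LimitedBits

open Literature.ComputerArithmetic.P3109
open Literature.ComputerArithmetic.ConnollyHighamMary2021
open Literature.ComputerArithmetic.FloatingPoint (Format MiniFloat)
open Literature.ComputerArithmetic.FloatingPoint.MiniFloat (valueSet valueSet_nonempty)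
open Summit.Ventures.CertifiedArithmetic.LowPrec.SR
open Finset

/-! ### Arithmetic of the top significands -/

/-- The product of the top significands: `2^(m₁+m₂+1) ≤ (2^(m₁+1)−1)(2^(m₂+1)−1) < 2^(m₁+m₂+2)`, odd. -/
theorem topSig_prod_bounds {m₁ m₂ : ℕ} (h₁ : 1 ≤ m₁) (h₂ : 1 ≤ m₂) :
    2 ^ (m₁ + m₂ + 1) ≤ (2 ^ (m₁ + 1) - 1) * (2 ^ (m₂ + 1) - 1) ∧
    (2 ^ (m₁ + 1) - 1) * (2 ^ (m₂ + 1) - 1) < 2 ^ (m₁ + m₂ + 2) ∧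
    Odd ((2 ^ (m₁ + 1) - 1) * (2 ^ (m₂ + 1) - 1)) := by
  have hA : 4 ≤ 2 ^ (m₁ + 1) := by
    calc 4 = 2 ^ 2 := by norm_num
      _ ≤ 2 ^ (m₁ + 1) := Nat.pow_le_pow_right (by norm_num) (by omega)
  have hB : 4 ≤ 2 ^ (m₂ + 1) := by
    calc 4 = 2 ^ 2 := by norm_num
      _ ≤ 2 ^ (m₂ + 1) := Nat.pow_le_pow_right (by norm_num) (by omega)
  set A := 2 ^ (m₁ + 1) with hAdef
  set B := 2 ^ (m₂ + 1) with hBdef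
  have hAB : 2 ^ (m₁ + m₂ + 2) = A * B := by rw [hAdef, hBdef, ← pow_add]; congr 1; omega
  have hAB1 : 2 ^ (m₁ + m₂ + 1) * 2 = A * B := by rw [← pow_succ, hAB]
  obtain ⟨K₁, hK₁⟩ : ∃ K, A = K + 1 := ⟨A - 1, by omega⟩
  obtain ⟨K₂, hK₂⟩ : ∃ K, B = K + 1 := ⟨B - 1, by omega⟩
  have e1 : A - 1 = K₁ := by omega
  have e2 : B - 1 = K₂ := by omega
  rw [e1, e2]
  refine ⟨?_, ?_, ?_⟩
  · have : (K₁ + 1) * (K₂ + 1) ≤ 2 * (K₁ * K₂) := by nlinarith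
    rw [hK₁, hK₂] at hAB1; nlinarith
  · rw [hAB, hK₁, hK₂]; nlinarith
  · have hoA : Odd K₁ := by
      have : Even A := by rw [hAdef]; exact (Nat.even_pow' (by omega)).mpr (by norm_num)
      rw [hK₁] at this; exact Nat.odd_iff.mpr (by rcases Nat.even_iff.mp this with h; omega)
    have hoB : Odd K₂ := by
      have : Even B := by rw [hBdef]; exact (Nat.even_pow' (by omega)).mpr (by norm_num)
      rw [hK₂] at this; exact Nat.odd_iff.mpr (by rcases Nat.even_iff.mp this with h; omega)
    exact hoA.mul hoB

/-- An odd numerator over `2^M`, `M ≥ 1`, is not an integer: its floor is strictly below it. -/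
theorem floor_lt_of_odd_div_two_pow {P M : ℕ} (hP : Odd P) (hM : 1 ≤ M) :
    ((⌊(P : ℚ) / 2 ^ M⌋ : ℤ) : ℚ) < (P : ℚ) / 2 ^ M := by
  rcases lt_or_eq_of_le (Int.floor_le ((P : ℚ) / 2 ^ M)) with h | h
  · exact h
  · exfalso
    obtain ⟨k, hk⟩ := hP
    have h2 : ((⌊(P : ℚ) / 2 ^ M⌋ * 2 ^ M : ℤ) : ℚ) = (P : ℚ) := by
      push_cast; rw [h]; field_simp
    have h3 : ⌊(P : ℚ) / 2 ^ M⌋ * 2 ^ M = (P : ℤ) := by exact_mod_cast h2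
    have h4 : (2 : ℤ) ∣ (P : ℤ) := by
      rw [← h3]; exact Dvd.dvd.mul_left (dvd_pow_self 2 (by omega)) _
    omega

/-- An odd numerator over `2^M` minus an integer is not an `(M−1)`-bit dyadic (`M ≥ 1`). -/
theorem not_dyadic_odd_div_sub {P M : ℕ} (hP : Odd P) (hM : 1 ≤ M) (z : ℤ) :
    ¬ Dyadic (M - 1) ((P : ℚ) / 2 ^ M - z) := by
  rintro ⟨n, hn⟩
  obtain ⟨k, hk⟩ := hP
  have h2M : (2 : ℚ) ^ M = 2 * 2 ^ (M - 1) := by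
    rw [← pow_succ']; congr 1; omega
  have h1 : ((n * 2 : ℤ) : ℚ) = ((P : ℤ) - z * 2 ^ M : ℤ) := by
    push_cast; rw [hn, h2M]; field_simp
  have h2 : n * 2 = (P : ℤ) - z * 2 ^ M := by exact_mod_cast h1
  have h3 : (2 : ℤ) ∣ z * 2 ^ M := Dvd.dvd.mul_left (dvd_pow_self 2 (by omega)) _
  omega

/-- A natural numerator over `2^M` minus an integer is an `M`-bit dyadic. -/
theorem dyadic_nat_div_sub {P M : ℕ} (z : ℤ) : Dyadic M ((P : ℚ) / 2 ^ M - z) :=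
  Dyadic.sub_int ⟨P, by push_cast; field_simp⟩ z

/-! ### The normal term of the product law is attained -/

/-- **The product law is exact in the normal regime.** Factor formats `φ₁`, `φ₂` with `mᵢ ≥ 1`,
accumulator `φ`, `M = m₁ + m₂ + 1 − m ≥ 1`; factors the LARGEST significands `Kᵢ = 2^(mᵢ+1) − 1` at
exponents `eᵢ` below the top binades (`eᵢ + 2 ≤ emaxCodeᵢ`), with the product falling in binade `s`
of `φ` below its top (`e₁ + e₂ + j + M = j₁ + j₂ + s`, `s + 2 ≤ emaxCode`).  Then both factors are
values, and the exact product SR-rounds into `valueSet φ` with up-probability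
`K₁K₂ / 2^M − ⌊K₁K₂ / 2^M⌋` — an `M`-bit dyadic (odd numerator) that is NOT an `(M−1)`-bit dyadic:
the normal term `m₁ + m₂ + 1 − m` of the (mixed) product law is attained. -/
theorem valueSet_prod_law_sharp_normal (φ φ₁ φ₂ : Format) (hm₁ : 1 ≤ φ₁.manBits)
    (hm₂ : 1 ≤ φ₂.manBits) (h : 1 ≤ φ.bias + φ.manBits) (h₁ : 1 ≤ φ₁.bias + φ₁.manBits)
    (h₂ : 1 ≤ φ₂.bias + φ₂.manBits) {M s e₁ e₂ : ℕ} (hM : φ.manBits + M = φ₁.manBits + φ₂.manBits + 1)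
    (hM1 : 1 ≤ M) (he₁ : e₁ + 2 ≤ φ₁.emaxCode) (he₂ : e₂ + 2 ≤ φ₂.emaxCode) (hsE : s + 2 ≤ φ.emaxCode)
    (hs : e₁ + e₂ + (φ.bias + φ.manBits - 1) + M
      = (φ₁.bias + φ₁.manBits - 1) + (φ₂.bias + φ₂.manBits - 1) + s) :
    (((2 ^ (φ₁.manBits + 1) - 1) * 2 ^ e₁ : ℕ) : ℚ) * φ₁.quantum ∈ valueSet φ₁ ∧
    (((2 ^ (φ₂.manBits + 1) - 1) * 2 ^ e₂ : ℕ) : ℚ) * φ₂.quantum ∈ valueSet φ₂ ∧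
    pUp (valueSet φ) ((((2 ^ (φ₁.manBits + 1) - 1) * 2 ^ e₁ : ℕ) : ℚ) * φ₁.quantum *
        ((((2 ^ (φ₂.manBits + 1) - 1) * 2 ^ e₂ : ℕ) : ℚ) * φ₂.quantum))
      = (((2 ^ (φ₁.manBits + 1) - 1) * (2 ^ (φ₂.manBits + 1) - 1) : ℕ) : ℚ) / 2 ^ M
        - ⌊(((2 ^ (φ₁.manBits + 1) - 1) * (2 ^ (φ₂.manBits + 1) - 1) : ℕ) : ℚ) / 2 ^ M⌋ ∧
    ¬ Dyadic (M - 1) (pUp (valueSet φ) ((((2 ^ (φ₁.manBits + 1) - 1) * 2 ^ e₁ : ℕ) : ℚ) * φ₁.quantum *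
        ((((2 ^ (φ₂.manBits + 1) - 1) * 2 ^ e₂ : ℕ) : ℚ) * φ₂.quantum))) ∧
    Dyadic M (pUp (valueSet φ) ((((2 ^ (φ₁.manBits + 1) - 1) * 2 ^ e₁ : ℕ) : ℚ) * φ₁.quantum *
        ((((2 ^ (φ₂.manBits + 1) - 1) * 2 ^ e₂ : ℕ) : ℚ) * φ₂.quantum))) := by
  set K₁ : ℕ := 2 ^ (φ₁.manBits + 1) - 1 with hK₁
  set K₂ : ℕ := 2 ^ (φ₂.manBits + 1) - 1 with hK₂
  set P : ℕ := K₁ * K₂ with hP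
  set j := φ.bias + φ.manBits - 1 with hj
  set j₁ := φ₁.bias + φ₁.manBits - 1 with hj₁
  set j₂ := φ₂.bias + φ₂.manBits - 1 with hj₂
  obtain ⟨hPl, hPu, hPodd⟩ := topSig_prod_bounds hm₁ hm₂
  rw [← hK₁, ← hK₂, ← hP] at hPl hPu hPodd
  have ha := MiniFloat.topSig_mem_valueSet (φ := φ₁) he₁
  have hb := MiniFloat.topSig_mem_valueSet (φ := φ₂) he₂
  rw [← hK₁] at ha; rw [← hK₂] at hb
  set a : ℚ := ((K₁ * 2 ^ e₁ : ℕ) : ℚ) * φ₁.quantum with ha_def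
  set b : ℚ := ((K₂ * 2 ^ e₂ : ℕ) : ℚ) * φ₂.quantum with hb_def
  have hq := φ.quantum_pos
  have hqj : φ.quantum = 1 / 2 ^ j := Format.quantum_eq_inv_two_pow h
  have hqj₁ : φ₁.quantum = 1 / 2 ^ j₁ := Format.quantum_eq_inv_two_pow h₁
  have hqj₂ : φ₂.quantum = 1 / 2 ^ j₂ := Format.quantum_eq_inv_two_pow h₂
  -- the exponent bookkeeping: a * b = P * 2^s / 2^M * quantum
  have key : (2 : ℚ) ^ e₁ * 2 ^ e₂ * 2 ^ j * 2 ^ M = 2 ^ j₁ * 2 ^ j₂ * 2 ^ s := by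
    simp only [← pow_add]; exact congrArg (fun n : ℕ => (2 : ℚ) ^ n) (by omega)
  have hc : a * b = (P : ℚ) * 2 ^ s / 2 ^ M * φ.quantum := by
    rw [ha_def, hb_def, hqj, hqj₁, hqj₂, hP]; push_cast
    field_simp
    linear_combination ((K₁ : ℚ) * K₂) * key
  have hP0 : (0 : ℚ) < P := by exact_mod_cast lt_of_lt_of_le (Nat.two_pow_pos _) hPl
  have hc0 : 0 < a * b := by
    rw [hc]; exact mul_pos (div_pos (mul_pos hP0 (by positivity)) (by positivity)) hq
  -- the scaled magnitude r = P * 2^s / 2^M, its floor n and binade s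
  have hr : |a * b| / φ.quantum = (P : ℚ) * 2 ^ s / 2 ^ M := by
    rw [abs_of_pos hc0, hc, mul_div_assoc, div_self hq.ne', mul_one]
  have hmM : φ.manBits + s + M = φ₁.manBits + φ₂.manBits + 1 + s := by omega
  have hlow : (2 : ℚ) ^ (φ.manBits + s) ≤ (P : ℚ) * 2 ^ s / 2 ^ M := by
    rw [le_div_iff₀ (by positivity), ← pow_add, hmM, pow_add]
    exact mul_le_mul_of_nonneg_right (by exact_mod_cast hPl) (by positivity)
  have hupp : (P : ℚ) * 2 ^ s / 2 ^ M < 2 ^ (φ.manBits + 1 + s) := by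
    rw [div_lt_iff₀ (by positivity), ← pow_add,
      show φ.manBits + 1 + s + M = φ₁.manBits + φ₂.manBits + 2 + s by omega, pow_add]
    exact mul_lt_mul_of_pos_right (by exact_mod_cast hPu) (by positivity)
  have hr0 : 0 ≤ |a * b| / φ.quantum := div_nonneg (abs_nonneg _) hq.le
  set n : ℕ := ⌊|a * b| / φ.quantum⌋.toNat with hn_def
  have hn_int : (n : ℤ) = ⌊|a * b| / φ.quantum⌋ := Int.toNat_of_nonneg (Int.floor_nonneg.mpr hr0)
  have hn1 : 2 ^ (φ.manBits + s) ≤ n := by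
    have : ((2 ^ (φ.manBits + s) : ℕ) : ℤ) ≤ ⌊|a * b| / φ.quantum⌋ := by
      rw [Int.le_floor]; push_cast; rw [hr]; exact hlow
    omega
  have hn2 : n < 2 ^ (φ.manBits + 1 + s) := by
    have : ⌊|a * b| / φ.quantum⌋ < ((2 ^ (φ.manBits + 1 + s) : ℕ) : ℤ) := by
      rw [Int.floor_lt]; push_cast; rw [hr]; exact hupp
    omega
  have hshift : φ.shift n = s := MiniFloat.shift_eq_of_bounds hn1 hn2 (by omega)
  -- no saturation: r < 2^(m+1+s) ≤ 2^(m + emaxCode - 1) ≤ maxScaled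
  have hle : |a * b| / φ.quantum ≤ φ.maxScaled := by
    rw [hr]; refine le_trans hupp.le ?_
    have h2 : 2 ^ (φ.manBits + 1 + s) ≤ φ.maxScaled := by
      rw [Format.maxScaled_eq (by omega)]
      calc 2 ^ (φ.manBits + 1 + s) ≤ 2 ^ (φ.manBits + (φ.emaxCode - 1)) :=
            Nat.pow_le_pow_right (by norm_num) (by omega)
        _ = 2 ^ φ.manBits * 2 ^ (φ.emaxCode - 1) := pow_add _ _ _
        _ ≤ (2 ^ φ.manBits + φ.topMan) * 2 ^ (φ.emaxCode - 1) :=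
            Nat.mul_le_mul_right _ (Nat.le_add_right _ _)
    exact_mod_cast h2
  have hcm : |a * b| ≤ φ.maxRat := by
    unfold Format.maxRat; rw [← div_le_iff₀ hq]; exact hle
  have hin : InHull (valueSet φ) (a * b) := (valueSet_inHull_iff φ _).mpr hcm
  -- the grid candidates: floor and ceiling of r / 2^s = P / 2^M
  have hrs : |a * b| / φ.quantum / 2 ^ s = (P : ℚ) / 2 ^ M := by
    rw [hr]; field_simp
  have hceil : ⌈(P : ℚ) / 2 ^ M⌉ = ⌊(P : ℚ) / 2 ^ M⌋ + 1 := by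
    rw [Int.ceil_eq_iff]; push_cast
    exact ⟨by linarith [floor_lt_of_odd_div_two_pow hPodd hM1],
      (Int.lt_floor_add_one ((P : ℚ) / 2 ^ M)).le⟩
  have hv : pUp (valueSet φ) (a * b) = (P : ℚ) / 2 ^ M - ⌊(P : ℚ) / 2 ^ M⌋ := by
    unfold pUp; rw [clamp_eq_self hin]; unfold probUp
    rw [MiniFloat.chm_roundDown_eq hcm, MiniFloat.chm_roundUp_eq hcm, MiniFloat.toRat_roundDown,
      MiniFloat.toRat_roundUp, if_neg (not_lt.mpr hc0.le), if_neg (not_lt.mpr hc0.le),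
      Format.rdGrid_cast hr0 hle, Format.ruGrid_cast hr0 hle, ← hn_def, hshift, hrs, hceil]
    have hab : a * b = (P : ℚ) / 2 ^ M * 2 ^ s * φ.quantum := by rw [hc]; ring
    rw [hab]; push_cast
    have h2s : (0 : ℚ) < 2 ^ s * φ.quantum := by positivity
    field_simp
    ring
  refine ⟨ha, hb, hv, ?_, ?_⟩
  · rw [hv]; exact not_dyadic_odd_div_sub hPodd hM1 _
  · rw [hv]; exact dyadic_nat_div_sub _

/-- Corollary (existential form): under the hypotheses of `valueSet_prod_law_sharp_normal` some exact
product of values needs exactly `N + 1 = m₁ + m₂ + 1 − m` random bits. -/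
theorem prod_law_normal_attained (φ φ₁ φ₂ : Format) (hm₁ : 1 ≤ φ₁.manBits) (hm₂ : 1 ≤ φ₂.manBits)
    (h : 1 ≤ φ.bias + φ.manBits) (h₁ : 1 ≤ φ₁.bias + φ₁.manBits) (h₂ : 1 ≤ φ₂.bias + φ₂.manBits)
    {N s e₁ e₂ : ℕ} (hM : φ.manBits + (N + 1) = φ₁.manBits + φ₂.manBits + 1)
    (he₁ : e₁ + 2 ≤ φ₁.emaxCode) (he₂ : e₂ + 2 ≤ φ₂.emaxCode) (hsE : s + 2 ≤ φ.emaxCode)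
    (hs : e₁ + e₂ + (φ.bias + φ.manBits - 1) + (N + 1)
      = (φ₁.bias + φ₁.manBits - 1) + (φ₂.bias + φ₂.manBits - 1) + s) :
    ∃ a ∈ valueSet φ₁, ∃ b ∈ valueSet φ₂,
      ¬ Dyadic N (pUp (valueSet φ) (a * b)) ∧ Dyadic (N + 1) (pUp (valueSet φ) (a * b)) := by
  obtain ⟨ha, hb, -, hn, hd⟩ :=
    valueSet_prod_law_sharp_normal φ φ₁ φ₂ hm₁ hm₂ h h₁ h₂ hM (Nat.succ_pos N) he₁ he₂ hsE hs
  exact ⟨_, ha, _, hb, by simpa using hn, hd⟩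

set_option maxRecDepth 8192 in
/-- **The normal term of the product law, format by format.**  Some exact product of two values needs
EXACTLY `m₁ + m₂ + 1 − m` random bits (an `(m₁+m₂+1−m)`-bit dyadic up-probability that is not one bit
shorter).  One-format squares/products (`m + 1` bits): E2M1 `2` (`3/2 · 3/2`), E2M3 `4` (`15/8 · 15/8`),
E3M2 `3` (`7/8 · 7/16`), E4M3 `4` (`15/64 · 15/128`), E5M2 `3`, binary16 `11`, bfloat16 `8`,
binary32 `24`; mixed FP4/FP6 → FP8 pipelines: E3M2·E3M2 → E5M2 `3`, E2M3·E2M3 → E4M3 `4`,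
E3M2·E2M3 → E4M3 `3`, E2M1·E3M2 → E5M2 `2`, E2M3·E2M3 → E5M2 `5` — the `MTERM` column of
`certs/sr/gen15/mixed`, previously certified by enumeration only.  Together with LXXXIV
(`prod_law_exact_formats`, `mixed_law_exact_pipelines`: the subnormal term) the product law
`max (m₁+m₂+1∸m) (j₁+j₂∸j)` is attained in every published row. -/
theorem prod_law_normal_formats :
    (∃ a ∈ valueSet Format.E2M1, ∃ b ∈ valueSet Format.E2M1,
      ¬ Dyadic 1 (pUp (valueSet Format.E2M1) (a * b)) ∧
        Dyadic 2 (pUp (valueSet Format.E2M1) (a * b))) ∧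
    (∃ a ∈ valueSet Format.E2M3, ∃ b ∈ valueSet Format.E2M3,
      ¬ Dyadic 3 (pUp (valueSet Format.E2M3) (a * b)) ∧
        Dyadic 4 (pUp (valueSet Format.E2M3) (a * b))) ∧
    (∃ a ∈ valueSet Format.E3M2, ∃ b ∈ valueSet Format.E3M2,
      ¬ Dyadic 2 (pUp (valueSet Format.E3M2) (a * b)) ∧
        Dyadic 3 (pUp (valueSet Format.E3M2) (a * b))) ∧
    (∃ a ∈ valueSet Format.E4M3, ∃ b ∈ valueSet Format.E4M3,
      ¬ Dyadic 3 (pUp (valueSet Format.E4M3) (a * b)) ∧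
        Dyadic 4 (pUp (valueSet Format.E4M3) (a * b))) ∧
    (∃ a ∈ valueSet Format.E5M2, ∃ b ∈ valueSet Format.E5M2,
      ¬ Dyadic 2 (pUp (valueSet Format.E5M2) (a * b)) ∧
        Dyadic 3 (pUp (valueSet Format.E5M2) (a * b))) ∧
    (∃ a ∈ valueSet Format.Binary16, ∃ b ∈ valueSet Format.Binary16,
      ¬ Dyadic 10 (pUp (valueSet Format.Binary16) (a * b)) ∧
        Dyadic 11 (pUp (valueSet Format.Binary16) (a * b))) ∧
    (∃ a ∈ valueSet Format.BFloat16, ∃ b ∈ valueSet Format.BFloat16,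
      ¬ Dyadic 7 (pUp (valueSet Format.BFloat16) (a * b)) ∧
        Dyadic 8 (pUp (valueSet Format.BFloat16) (a * b))) ∧
    (∃ a ∈ valueSet Format.Binary32, ∃ b ∈ valueSet Format.Binary32,
      ¬ Dyadic 23 (pUp (valueSet Format.Binary32) (a * b)) ∧
        Dyadic 24 (pUp (valueSet Format.Binary32) (a * b))) ∧
    (∃ a ∈ valueSet Format.E3M2, ∃ b ∈ valueSet Format.E3M2,
      ¬ Dyadic 2 (pUp (valueSet Format.E5M2) (a * b)) ∧
        Dyadic 3 (pUp (valueSet Format.E5M2) (a * b))) ∧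
    (∃ a ∈ valueSet Format.E2M3, ∃ b ∈ valueSet Format.E2M3,
      ¬ Dyadic 3 (pUp (valueSet Format.E4M3) (a * b)) ∧
        Dyadic 4 (pUp (valueSet Format.E4M3) (a * b))) ∧
    (∃ a ∈ valueSet Format.E3M2, ∃ b ∈ valueSet Format.E2M3,
      ¬ Dyadic 2 (pUp (valueSet Format.E4M3) (a * b)) ∧
        Dyadic 3 (pUp (valueSet Format.E4M3) (a * b))) ∧
    (∃ a ∈ valueSet Format.E2M1, ∃ b ∈ valueSet Format.E3M2,
      ¬ Dyadic 1 (pUp (valueSet Format.E5M2) (a * b)) ∧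
        Dyadic 2 (pUp (valueSet Format.E5M2) (a * b))) ∧
    (∃ a ∈ valueSet Format.E2M3, ∃ b ∈ valueSet Format.E2M3,
      ¬ Dyadic 4 (pUp (valueSet Format.E5M2) (a * b)) ∧
        Dyadic 5 (pUp (valueSet Format.E5M2) (a * b))) := by
  refine ⟨?_, ?_, ?_, ?_, ?_, ?_, ?_, ?_, ?_, ?_, ?_, ?_, ?_⟩
  · exact prod_law_normal_attained _ _ _ (by decide) (by decide) (by decide) (by decide) (by decide)
      (s := 1) (e₁ := 0) (e₂ := 0) (by decide) (by decide) (by decide) (by decide) (by decide)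
  · exact prod_law_normal_attained _ _ _ (by decide) (by decide) (by decide) (by decide) (by decide)
      (s := 1) (e₁ := 0) (e₂ := 0) (by decide) (by decide) (by decide) (by decide) (by decide)
  · exact prod_law_normal_attained _ _ _ (by decide) (by decide) (by decide) (by decide) (by decide)
      (s := 0) (e₁ := 1) (e₂ := 0) (by decide) (by decide) (by decide) (by decide) (by decide)
  · exact prod_law_normal_attained _ _ _ (by decide) (by decide) (by decide) (by decide) (by decide)
      (s := 0) (e₁ := 3) (e₂ := 2) (by decide) (by decide) (by decide) (by decide) (by decide)
  · exact prod_law_normal_attained _ _ _ (by decide) (by decide) (by decide) (by decide) (by decide)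
      (s := 0) (e₁ := 7) (e₂ := 6) (by decide) (by decide) (by decide) (by decide) (by decide)
  · exact prod_law_normal_attained _ _ _ (by decide) (by decide) (by decide) (by decide) (by decide)
      (s := 0) (e₁ := 7) (e₂ := 6) (by decide) (by decide) (by decide) (by decide) (by decide)
  · exact prod_law_normal_attained _ _ _ (by decide) (by decide) (by decide) (by decide) (by decide)
      (s := 0) (e₁ := 63) (e₂ := 62) (by decide) (by decide) (by decide) (by decide) (by decide)
  · exact prod_law_normal_attained _ _ _ (by decide) (by decide) (by decide) (by decide) (by decide)
      (s := 0) (e₁ := 63) (e₂ := 62) (by decide) (by decide) (by decide) (by decide) (by decide)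
  · exact prod_law_normal_attained _ _ _ (by decide) (by decide) (by decide) (by decide) (by decide)
      (s := 11) (e₁ := 0) (e₂ := 0) (by decide) (by decide) (by decide) (by decide) (by decide)
  · exact prod_law_normal_attained _ _ _ (by decide) (by decide) (by decide) (by decide) (by decide)
      (s := 7) (e₁ := 0) (e₂ := 0) (by decide) (by decide) (by decide) (by decide) (by decide)
  · exact prod_law_normal_attained _ _ _ (by decide) (by decide) (by decide) (by decide) (by decide)
      (s := 5) (e₁ := 0) (e₂ := 0) (by decide) (by decide) (by decide) (by decide) (by decide)
  · exact prod_law_normal_attained _ _ _ (by decide) (by decide) (by decide) (by decide) (by decide)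
      (s := 13) (e₁ := 0) (e₂ := 0) (by decide) (by decide) (by decide) (by decide) (by decide)
  · exact prod_law_normal_attained _ _ _ (by decide) (by decide) (by decide) (by decide) (by decide)
      (s := 15) (e₁ := 0) (e₂ := 0) (by decide) (by decide) (by decide) (by decide) (by decide)

end Summit.Ventures.CertifiedArithmetic.LowPrec.SR.LimitedBits
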